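import Literature.IUT.HodgeArakelov.TemperedThetaMonoidsSubdagStatements
import Literature.IUT.HodgeArakelov.ConstantMultipleRigidity
import Literature.IUT.HodgeArakelov.IotaInvariantThetaR
import HarnessLib

/-!
# [IUTchII] Prop 3.1: the producer → record DATA BRIDGE `M^Θ_* ↦ (lim_J H¹, Π_X-action, M_TM, {θ^ι_env, ∞θ^ι_env}_ι)`

S. Mochizuki, *Inter-universal Teichmüller theory II*, kurims manuscript (Dec. 2020), §3 Prop. 3.1 (i)(ii)
pp. 87–88 [cite: Mochizuki2012, Prop 3.1 (i) p.87]: "By applying the constructions of Proposition 1.5, (iii);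
Corollary 2.8, (i) [cf. also Corollary 1.12, (d)], one obtains a functorial algorithm
`M^Θ_* ↦ {M^×_TM(M^Θ_*), θ^ι_env(M^Θ_*), ∞θ^ι_env(M^Θ_*), … ⊆ lim_J H¹(Π_Ÿ(M^Θ_*)|_J, Π_μ(M^Θ_*))}_ι` … where `ι` ranges
over the inversion automorphisms of Proposition 2.2, (i) … equipped with a natural conjugation action by
`Π_X(M^Θ_*)`" and (ii) "`Ψ_cns(M^Θ_*) := M_TM(M^Θ_*) ⊆ lim_J H¹(…)`". Claim key `Mochizuki2012` (D-0012, DISPUTED);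
nothing of the series is asserted here — this file is PLUMBING between two typings already in the tree.

abc-iut cell, sub-DAG `plan/L6/SUBDAG-IUTchII-Prop-31-33-34.md` (W6-S6, holder abc-iut-w5-d169), junction **J1**
(row P31.i.r2: "BRIDGE producer → record NOT built"), seat abc-iut-w4-d019 (GO: abc-iut-L6-lead §F v1.18a (b)).
PRODUCER side (abc-iut-L6-t1): `ThetaEnvData Sys` (`MonoThetaProjective`, p407497: the Prop. 1.5 (iii) output —
`cohEnv = J ↦ H¹(Π_Ÿ(M^Θ_*)|_J, Π_μ(M^Θ_*))`, `transportLim`, `θ_env`, `∞θ_env`), the Cor. 1.12 (i) notation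
`iotaInvariants` / `iotaQuotOf` (`ConstantMultipleRigidity`, p410537) and the repaired Prop. 2.2 (ii) output
`IotaInvariantTheta'` (`IotaInvariantThetaR`, p408487). RECORD side (abc-iut-L6-t2): `TemperedThetaMonoids.ThetaEnvData P`
(`TemperedThetaMonoids`, p404874: ambient `H`, `conj : P →* MulAut H`, `Iota`, `units`, `constants`, `θ^ι_env`, `∞θ^ι_env`),
over which Prop. 3.1's monoids `Ψ^ι_env`, `∞Ψ^ι_env`, `Ψ_cns` are REAL and the Prop. 3.1 closers are landed
(`TemperedThetaMonoidsProofs2` p411800, `…SubdagProofs` p416097, `…ModelProofs` p413806).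

WHAT THE PRODUCER INTERFACES DO NOT CARRY (and this file therefore takes as explicit DATA, never as a `Prop`):
(a) the `Π_X(M^Θ_*)`-action on the ambient direct limit (`CohomologySystem` has no functoriality in automorphisms —
audit note F4c; at the model it is abc-iut-L6-t1's `h1LimAutEquiv`, `CohomologyAutEquiv` p412842, along conjugation):
`act : Π_X →* MulAut (lim_J H¹)` (the limit written multiplicatively, as in abc-iut-w4-d007's `cohLimConj`);
(b) the Kummer map of the constant monoid `κ : M_TM(Π_X) → lim_J H¹`
(plan/GAP-LEDGER.md G-w4d019-1; at the [AbsTopIII] Def. 3.1 (i) model abc-iut-w4-d007's `constantsKummerHom`,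
p413325); (c) the family of inversion automorphisms `ι` through their actions on the direct limit
(`iota : Iota → (lim ≃+ lim)`, the `iotaLim` of `IotaInvariantTheta'` / `ThetaEvaluation`).

CONSTRUCTED / PROVED here:
* `ThetaEnvData.toRecord T act κ iota : TemperedThetaMonoids.ThetaEnvData Π_X(M^Θ_*)` — `H := lim_J H¹(…, Π_μ)`
  (multiplicatively), `conj := act`, `constants := Ψ_cns := κ(M_TM)` (printed "`Ψ_cns := M_TM`"), `units :=` the
  units of `Ψ_cns` (printed `M^×_TM`; `units_eq` holds BY CONSTRUCTION), `θ^ι_env` / `∞θ^ι_env :=` the transport along the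
  cyclotomic rigidity isomorphism (`transportLim`, Prop. 1.5 (iii) / Cor. 2.8 (i)) of the `ι`-invariants UP TO TORSION
  (Cor. 1.12 (i) convention) of `θ(Π)` (read in the limit) resp. `∞θ(Π)`; `theta_subset` PROVED (`θ ⊆ ∞θ` in the limit);
* `kummerInput_toRecord` — the record satisfies abc-iut-w5-d169's **J4** `KummerInput` as soon as `κ` is injective and
  `Π_X`-equivariant (the two printed properties; G-w4d019-1's datum), the third clause `Ψ_cns = mrange κ` being `rfl`;
* `mem_toRecord_units_iff_of_injective` — for injective `κ`, `M^×_TM` of the record = `κ((M_TM)ˣ)` (units go to units);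
* `thetaEnvPermuted_toRecord` — **J2** (`ThetaEnvPermuted`: the conjugation action permutes `{θ^ι_env}_ι`, `{∞θ^ι_env}_ι`)
  PROVED from: a `Π_X`-action on the `(l·Δ_Θ)`-side limit compatible with `act` through `transportLim` (equivariance of
  the cyclotomic rigidity isomorphism), stabilising `θ(Π)` and `∞θ(Π)` (they are defined from the characteristic orbit
  `η̈^{Θ,l·ℤ×μ_2}`, Prop. 1.4), and carrying each inversion action to the action of another inversion
  (`ι ↦ g ι g⁻¹`: "conjugates of inversion automorphisms are inversion automorphisms", Prop. 2.2 (i));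
* `toLim_image_thetaIota_subset` — consistency with the decl of record `IotaInvariantTheta'.thetaIota` (Prop. 2.2 (ii)′):
  the image in the limit of `θ^ι(Π_v)` lies in the `ι`-invariants up to torsion used here (equality needs the torsion-ness
  of `Ker(H¹(Π_Ÿ) → lim_J)`, which the abstract `CohomologySystem` does not record — stated as the hypothesis it is).
HONEST FRAMING: a definitional bridge; it makes the landed Prop. 3.1 closers APPLICABLE to producer data and narrows
G-w4d019-1 to the model instance of (a)(b); it discharges no disputed claim and takes no side on [IUTchIII] Cor. 3.12.
-/

namespace Literature.IUT.HodgeArakelov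

universe u

/-! ### Generic plumbing: units of a submonoid of a commutative group -/

section Generic

/-- The group of units `C^×` of a submonoid `C` of a commutative group, as a subgroup of the ambient group:
`{x | x ∈ C ∧ x⁻¹ ∈ C}` (the record side's `units_eq` convention "`M^×_TM` is the group of units of `M_TM`").
[claim: Mochizuki2012, status: disputed] (IUTchII §3 Prop 3.1 (ii), kurims p.88) -/
def unitsOfSubmonoid {H : Type u} [CommGroup H] (C : Submonoid H) : Subgroup H where
  carrier := {x | x ∈ C ∧ x⁻¹ ∈ C}
  one_mem' := ⟨C.one_mem, by simpa only [inv_one] using C.one_mem⟩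
  mul_mem' := fun {a b} ha hb => ⟨C.mul_mem ha.1 hb.1, by rw [mul_inv]; exact C.mul_mem ha.2 hb.2⟩
  inv_mem' := fun {a} ha => ⟨ha.2, by simpa only [inv_inv] using ha.1⟩

/-- Membership in `unitsOfSubmonoid C`. [claim: Mochizuki2012, status: disputed] (IUTchII §3 Prop 3.1 (ii), kurims p.88) -/
@[simp] theorem mem_unitsOfSubmonoid_iff {H : Type u} [CommGroup H] (C : Submonoid H) (x : H) :
    x ∈ unitsOfSubmonoid C ↔ x ∈ C ∧ x⁻¹ ∈ C := Iff.rfl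

/-- For an INJECTIVE monoid homomorphism `κ : M → H` into a commutative group, the units of the image monoid
`κ(M)` are exactly the images of the units of `M` (Kummer maps of MLF's are injective, [AbsTopIII] Prop. 3.2 (ii);
so `M^×_TM ↦ M^×_TM` under `M_TM ↪ lim_J H¹`). [claim: Mochizuki2012, status: disputed] (IUTchII §3 Prop 3.1 (ii), kurims p.88) -/
theorem mem_unitsOfSubmonoid_mrange_iff {H : Type u} [CommGroup H] {M : Type u} [CommMonoid M]
    (κ : M →* H) (hκ : Function.Injective κ) (x : H) :
    x ∈ unitsOfSubmonoid (MonoidHom.mrange κ) ↔ ∃ u : Mˣ, κ (u : M) = x := by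
  constructor
  · rintro ⟨⟨m, rfl⟩, ⟨m', hm'⟩⟩
    have hmm' : m * m' = 1 := hκ (by rw [map_mul, hm', mul_inv_cancel, map_one])
    exact ⟨⟨m, m', hmm', by rw [mul_comm]; exact hmm'⟩, rfl⟩
  · rintro ⟨u, rfl⟩
    refine ⟨⟨u, rfl⟩, ⟨((u⁻¹ : Mˣ) : M), ?_⟩⟩
    rw [eq_inv_iff_mul_eq_one, ← map_mul, Units.inv_mul, map_one]

end Generic

/-! ### The `ι`-invariants up to torsion of `θ(Π)` / `∞θ(Π)` in the limit, and their transport to `Π_μ`-coefficients -/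

namespace ThetaEnvData

variable {S : ThetaSetting.{u}} {F : ModelFamily S} {Sys : MonoThetaProjSystem F} (T : ThetaEnvData Sys)

/-- `θ^ι(Π)` read in the direct limit: the `ι`-invariants UP TO TORSION ([IUTchII] Cor. 1.12 (i) convention,
`iotaInvariants` / `iotaQuotOf`) of the image of `θ(Π)` in `lim_J H¹(Π_Ÿ(Π)|_J, (l·Δ_Θ)(Π))`, for the action
`e` of an inversion automorphism `ι` on the limit. [claim: Mochizuki2012, status: disputed] (IUTchII §2 Prop 2.2 (ii), kurims p.66) -/
def thetaIotaLim (e : T.D.coh.lim ≃+ T.D.coh.lim) : Set T.D.coh.lim :=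
  iotaInvariants (iotaQuotOf e : _ →+ _) (T.D.coh.toLim ⊤ '' T.D.theta)

/-- `∞θ^ι(Π)`: the `ι`-invariants up to torsion of `∞θ(Π)` (Prop. 1.4) for the action `e` of `ι` on the limit.
[claim: Mochizuki2012, status: disputed] (IUTchII §2 Prop 2.2 (ii), kurims p.66) -/
def thetaInftyIotaLim (e : T.D.coh.lim ≃+ T.D.coh.lim) : Set T.D.coh.lim :=
  iotaInvariants (iotaQuotOf e : _ →+ _) T.D.thetaInfty

/-- Membership in `θ^ι(Π)` (limit form). [claim: Mochizuki2012, status: disputed] (IUTchII §2 Prop 2.2 (ii), kurims p.66) -/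
theorem mem_thetaIotaLim_iff (e : T.D.coh.lim ≃+ T.D.coh.lim) (x : T.D.coh.lim) :
    x ∈ T.thetaIotaLim e ↔ x ∈ T.D.coh.toLim ⊤ '' T.D.theta ∧ IsOfFinAddOrder (e x - x) :=
  mem_iotaInvariants_iff e _ x

/-- Membership in `∞θ^ι(Π)`. [claim: Mochizuki2012, status: disputed] (IUTchII §2 Prop 2.2 (ii), kurims p.66) -/
theorem mem_thetaInftyIotaLim_iff (e : T.D.coh.lim ≃+ T.D.coh.lim) (x : T.D.coh.lim) :
    x ∈ T.thetaInftyIotaLim e ↔ x ∈ T.D.thetaInfty ∧ IsOfFinAddOrder (e x - x) :=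
  mem_iotaInvariants_iff e _ x

/-- `θ(Π) ⊆ ∞θ(Π)` in the limit (the positive multiple `1` already coincides, up to the torsion class `0`).
[claim: Mochizuki2012, status: disputed] (IUTchII §1 Prop 1.4, kurims p.27) -/
theorem toLim_image_theta_subset_thetaInfty : T.D.coh.toLim ⊤ '' T.D.theta ⊆ T.D.thetaInfty := by
  rintro x ⟨t, ht, rfl⟩
  refine ⟨1, Nat.one_pos, t, ht, ?_⟩
  rw [one_smul, sub_self]
  exact IsOfFinAddOrder.zero

/-- `θ^ι(Π) ⊆ ∞θ^ι(Π)` (limit form). [claim: Mochizuki2012, status: disputed] (IUTchII §2 Prop 2.2 (ii), kurims p.66) -/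
theorem thetaIotaLim_subset (e : T.D.coh.lim ≃+ T.D.coh.lim) : T.thetaIotaLim e ⊆ T.thetaInftyIotaLim e := by
  intro x hx
  rw [mem_thetaIotaLim_iff] at hx
  exact (T.mem_thetaInftyIotaLim_iff e x).2 ⟨T.toLim_image_theta_subset_thetaInfty hx.1, hx.2⟩

/-- Transport of a subset of `lim_J H¹(…, (l·Δ_Θ))` to `lim_J H¹(…, Π_μ)` along the cyclotomic rigidity isomorphism
(`transportLim`, [IUTchII] Prop. 1.5 (iii) / Cor. 2.8 (i)), written multiplicatively.
[claim: Mochizuki2012, status: disputed] (IUTchII §1 Prop 1.5 (iii), kurims p.30) -/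
def envSet (X : Set T.D.coh.lim) : Set (Multiplicative T.cohEnv.lim) :=
  Multiplicative.ofAdd '' (T.transportLim '' X)

/-- `envSet` is monotone. [claim: Mochizuki2012, status: disputed] (IUTchII §1 Prop 1.5 (iii), kurims p.30) -/
theorem envSet_mono {X Y : Set T.D.coh.lim} (h : X ⊆ Y) : T.envSet X ⊆ T.envSet Y :=
  Set.image_mono (Set.image_mono h)

/-- Membership in `envSet`. [claim: Mochizuki2012, status: disputed] (IUTchII §1 Prop 1.5 (iii), kurims p.30) -/
theorem mem_envSet_iff (X : Set T.D.coh.lim) (y : Multiplicative T.cohEnv.lim) :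
    y ∈ T.envSet X ↔ T.transportLim.symm (Multiplicative.toAdd y) ∈ X := by
  constructor
  · rintro ⟨_, ⟨x, hx, rfl⟩, rfl⟩
    simpa using hx
  · intro h
    exact ⟨T.transportLim (T.transportLim.symm (Multiplicative.toAdd y)), ⟨_, h, rfl⟩, by simp⟩

/-- `envSet X` as a single image. [claim: Mochizuki2012, status: disputed] (IUTchII §1 Prop 1.5 (iii), kurims p.30) -/
theorem envSet_eq (X : Set T.D.coh.lim) :
    T.envSet X = (fun x => Multiplicative.ofAdd (T.transportLim x)) '' X := by
  rw [envSet, Set.image_image]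

/-- An automorphism of the `Π_μ`-side limit intertwined, through the cyclotomic rigidity isomorphism, with an
automorphism of the `(l·Δ_Θ)`-side limit carries `envSet X` to `envSet` of the image.
[claim: Mochizuki2012, status: disputed] (IUTchII §1 Prop 1.5 (iii), kurims p.30) -/
theorem image_envSet_of_compat (φ : MulAut (Multiplicative T.cohEnv.lim)) (a : T.D.coh.lim ≃+ T.D.coh.lim)
    (h : ∀ x, φ (Multiplicative.ofAdd (T.transportLim x)) = Multiplicative.ofAdd (T.transportLim (a x)))
    (X : Set T.D.coh.lim) : φ '' T.envSet X = T.envSet (a '' X) := by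
  rw [envSet_eq, envSet_eq, Set.image_image, Set.image_image]
  exact Set.image_congr fun x _ => h x

/-! ### The bridge -/

/-- **J1 — the Prop. 3.1 input record PRODUCED from the Prop. 1.5 (iii) data** ([IUTchII] Prop. 3.1 (i)(ii) pp. 87–88
"one obtains a functorial algorithm `M^Θ_* ↦ {M^×_TM(M^Θ_*), θ^ι_env(M^Θ_*), ∞θ^ι_env(M^Θ_*), …}_ι` … equipped with a
natural conjugation action by `Π_X(M^Θ_*)`"; "`Ψ_cns(M^Θ_*) := M_TM(M^Θ_*)`"): over abc-iut-L6-t1's `T : ThetaEnvData Sys`,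
GIVEN (a) the `Π_X`-action `act` on `lim_J H¹(Π_Ÿ(M^Θ_*)|_J, Π_μ(M^Θ_*))`, (b) the Kummer map `κ` of the constant monoid
`M_TM(Π_X(M^Θ_*))` (valued in the same limit; GAP row G-w4d019-1's datum) and (c) the inversion automorphisms `ι`
through their actions on `lim_J H¹(…, (l·Δ_Θ))`, the record of abc-iut-L6-t2: `H := lim_J H¹` (multiplicative),
`conj := act`, `constants := Ψ_cns := κ(M_TM)`, `units := (Ψ_cns)^× = M^×_TM`, `θ^ι_env` / `∞θ^ι_env :=` transport along the
cyclotomic rigidity isomorphism of `θ^ι(Π)` / `∞θ^ι(Π)` (ι-invariants up to torsion, Cor. 1.12 (i) convention).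
[claim: Mochizuki2012, status: disputed] (IUTchII §3 Prop 3.1 (i), kurims p.87) -/
def toRecord (act : Sys.PiX →* MulAut (Multiplicative T.cohEnv.lim)) {M : Type u} [CommMonoid M]
    (κ : M →* Multiplicative T.cohEnv.lim) {Iota : Type u} (iota : Iota → (T.D.coh.lim ≃+ T.D.coh.lim)) :
    TemperedThetaMonoids.ThetaEnvData.{u, u} Sys.PiX where
  H := CommGrpCat.of (Multiplicative T.cohEnv.lim)
  conj := act
  Iota := Iota
  units := unitsOfSubmonoid (MonoidHom.mrange κ)
  constants := MonoidHom.mrange κ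
  units_eq := fun _ => Iff.rfl
  thetaEnv := fun ι => T.envSet (T.thetaIotaLim (iota ι))
  inftyThetaEnv := fun ι => T.envSet (T.thetaInftyIotaLim (iota ι))
  theta_subset := fun ι => T.envSet_mono (T.thetaIotaLim_subset (iota ι))

section Record

variable (act : Sys.PiX →* MulAut (Multiplicative T.cohEnv.lim)) {M : Type u} [CommMonoid M]
  (κ : M →* Multiplicative T.cohEnv.lim) {Iota : Type u} (iota : Iota → (T.D.coh.lim ≃+ T.D.coh.lim))

/-- The record's conjugation action is `act`. [claim: Mochizuki2012, status: disputed] (IUTchII §3 Prop 3.1 (i), kurims p.87) -/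
theorem toRecord_conj : (T.toRecord act κ iota).conj = act := rfl

/-- `Ψ_cns` of the record IS the image of the Kummer map ("`Ψ_cns := M_TM`").
[claim: Mochizuki2012, status: disputed] (IUTchII §3 Prop 3.1 (ii), kurims p.88) -/
theorem toRecord_constantMonoid : (T.toRecord act κ iota).constantMonoid = MonoidHom.mrange κ := rfl

/-- `θ^ι_env` of the record, unfolded. [claim: Mochizuki2012, status: disputed] (IUTchII §3 Prop 3.1 (i), kurims p.87) -/
theorem toRecord_thetaEnv (ι : Iota) :
    (T.toRecord act κ iota).thetaEnv ι = T.envSet (T.thetaIotaLim (iota ι)) := rfl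

/-- `∞θ^ι_env` of the record, unfolded. [claim: Mochizuki2012, status: disputed] (IUTchII §3 Prop 3.1 (i), kurims p.87) -/
theorem toRecord_inftyThetaEnv (ι : Iota) :
    (T.toRecord act κ iota).inftyThetaEnv ι = T.envSet (T.thetaInftyIotaLim (iota ι)) := rfl

/-- `M^×_TM` of the record: the units of `Ψ_cns`. [claim: Mochizuki2012, status: disputed] (IUTchII §3 Prop 3.1 (ii), kurims p.88) -/
theorem mem_toRecord_units_iff (x : (T.toRecord act κ iota).H) :
    x ∈ (T.toRecord act κ iota).units ↔ x ∈ MonoidHom.mrange κ ∧ x⁻¹ ∈ MonoidHom.mrange κ := Iff.rfl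

/-- For an injective Kummer map, `M^×_TM` of the record = `κ((M_TM)ˣ)`: the units of `M_TM(Π_X)` ([IUTchII] Ex. 1.8 (iii)
"`M^×_TM`") are carried onto the unit subgroup of the record. [claim: Mochizuki2012, status: disputed] (IUTchII §3 Prop 3.1 (ii), kurims p.88) -/
theorem mem_toRecord_units_iff_of_injective (hκ : Function.Injective κ) (x : (T.toRecord act κ iota).H) :
    x ∈ (T.toRecord act κ iota).units ↔ ∃ u : Mˣ, κ (u : M) = x :=
  mem_unitsOfSubmonoid_mrange_iff κ hκ x

/-- The isomorphism class of `Π_X(M^Θ_*)` — an isomorph of `Π^tp_{X̲̲_k}` by the Prop. 1.4 datum `isoRef` — at which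
abc-iut-L6-t1's `AbsTopMonoids.MTM` ([IUTchII] Ex. 1.8 (ii) `M_TM(Π)`) is evaluated. [claim: Mochizuki2012, status: disputed] (IUTchII §1 Ex 1.8 (ii), kurims p.36) -/
def piXClass : IsoClass S.PiX := ⟨Sys.PiX, T.D.isoRef⟩

/-- `(T.piXClass).G = Π_X(M^Θ_*)` by construction. [claim: Mochizuki2012, status: disputed] (IUTchII §1 Ex 1.8 (ii), kurims p.36) -/
theorem piXClass_G : T.piXClass.G = Sys.PiX := rfl

end Record

/-- **J4 from the two printed properties of the Kummer map** ([IUTchII] Prop. 3.1 (ii) p.88; [AbsTopIII] Prop. 3.2 (ii)):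
if the Kummer map `κ : M_TM(Π_X(M^Θ_*)) → lim_J H¹` is INJECTIVE and `Π_X`-EQUIVARIANT (for `act`), the produced record
satisfies abc-iut-w5-d169's `KummerInput` — its third clause "`Ψ_cns = mrange κ`" holds by construction. So the landed
Prop. 3.1 (ii) closers (`prop31ii_of_kummerInput`, p416097; `constants_stable_of_equivariant_mrange`, p412769) apply to
producer data. [claim: Mochizuki2012, status: disputed] (IUTchII §3 Prop 3.1 (ii), kurims p.88) -/
theorem kummerInput_toRecord (A : AbsTopMonoids S) (act : Sys.PiX →* MulAut (Multiplicative T.cohEnv.lim))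
    (κ : A.MTM T.piXClass →* Multiplicative T.cohEnv.lim) {Iota : Type u}
    (iota : Iota → (T.D.coh.lim ≃+ T.D.coh.lim)) (hinj : Function.Injective κ)
    (hequiv : ∀ (x : Sys.PiX) (m : A.MTM T.piXClass), κ (A.actMTM T.piXClass x m) = act x (κ m)) :
    TemperedThetaMonoids.ThetaEnvData.KummerInput A T.piXClass (T.toRecord act κ iota) :=
  ⟨κ, hinj, fun x m => hequiv x m, rfl⟩

/-! ### J2: the conjugation action permutes `{θ^ι_env}_ι`, `{∞θ^ι_env}_ι` -/

section Permuted

variable {act : Sys.PiX →* MulAut (Multiplicative T.cohEnv.lim)} {M : Type u} [CommMonoid M]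
  {κ : M →* Multiplicative T.cohEnv.lim} {Iota : Type u} {iota : Iota → (T.D.coh.lim ≃+ T.D.coh.lim)}
  {actD : Sys.PiX → (T.D.coh.lim ≃+ T.D.coh.lim)}

/-- Conjugating the action of `ι` by an automorphism `a` of the limit carries the `ι`-invariants up to torsion of an
`a`-stable subset onto the invariants for the conjugated action ("conjugates of inversion automorphisms are inversion
automorphisms", [IUTchII] Prop. 2.2 (i)). [claim: Mochizuki2012, status: disputed] (IUTchII §2 Prop 2.2 (i), kurims p.66) -/
theorem image_iotaInvariants_of_conj (a e e' : T.D.coh.lim ≃+ T.D.coh.lim)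
    (he' : ∀ x, e' (a x) = a (e x)) {X : Set T.D.coh.lim} (hX : a '' X = X) :
    a '' iotaInvariants (iotaQuotOf e : _ →+ _) X = iotaInvariants (iotaQuotOf e' : _ →+ _) X := by
  ext y
  simp only [Set.mem_image, mem_iotaInvariants_iff]
  constructor
  · rintro ⟨x, ⟨hx, htor⟩, rfl⟩
    refine ⟨?_, ?_⟩
    · rw [← hX]; exact ⟨x, hx, rfl⟩
    · rw [he', ← map_sub]
      exact (a : T.D.coh.lim →+ T.D.coh.lim).isOfFinAddOrder htor
  · rintro ⟨hy, htor⟩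
    have hy' : a.symm y ∈ X := by
      rw [← hX] at hy
      obtain ⟨x, hx, rfl⟩ := hy
      simpa using hx
    refine ⟨a.symm y, ⟨hy', ?_⟩, by simp⟩
    have h1 : e' y - y = a (e (a.symm y) - a.symm y) := by
      rw [map_sub, ← he', AddEquiv.apply_symm_apply]
    have h2 := (a.symm : T.D.coh.lim →+ T.D.coh.lim).isOfFinAddOrder htor
    rw [h1] at h2
    simpa using h2

/-- **J2** (`ThetaEnvPermuted`, [IUTchII] Prop. 3.1 (i) p.87 l.47–53 "this collection of subsets is equipped with a
natural conjugation action by `Π_X(M^Θ_*)`") for the PRODUCED record, from: a `Π_X`-action `actD` on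
`lim_J H¹(…, (l·Δ_Θ))` intertwined with `act` by the cyclotomic rigidity isomorphism (`hcompat`), stabilising the images
of `θ(Π)` and of `∞θ(Π)` (`hθ`, `hinf` — both are defined from the characteristic orbit `η̈^{Θ,l·ℤ×μ_2}` of Prop. 1.4), and
carrying the action of each inversion `ι` to that of an inversion `ι'` (`hι`: `ι' = g ι g⁻¹`, Prop. 2.2 (i)). Then
`g · θ^ι_env = θ^{ι'}_env` and `g · ∞θ^ι_env = ∞θ^{ι'}_env`; so `Prop31Statements.conj_permutes` follows by the landed
`conj_permutes_both_of_thetaEnvPermuted` (p416097). [claim: Mochizuki2012, status: disputed] (IUTchII §3 Prop 3.1 (i), kurims p.87) -/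
theorem thetaEnvPermuted_toRecord
    (hcompat : ∀ (g : Sys.PiX) (x : T.D.coh.lim),
      act g (Multiplicative.ofAdd (T.transportLim x)) = Multiplicative.ofAdd (T.transportLim (actD g x)))
    (hθ : ∀ g : Sys.PiX, actD g '' (T.D.coh.toLim ⊤ '' T.D.theta) = T.D.coh.toLim ⊤ '' T.D.theta)
    (hinf : ∀ g : Sys.PiX, actD g '' T.D.thetaInfty = T.D.thetaInfty)
    (hι : ∀ (g : Sys.PiX) (ι : Iota), ∃ ι' : Iota, ∀ x, iota ι' (actD g x) = actD g (iota ι x)) :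
    (T.toRecord act κ iota).ThetaEnvPermuted := by
  intro g ι
  obtain ⟨ι', hι'⟩ := hι g ι
  refine ⟨ι', ?_, ?_⟩
  · change (act g) '' T.envSet (T.thetaIotaLim (iota ι)) = T.envSet (T.thetaIotaLim (iota ι'))
    rw [T.image_envSet_of_compat (act g) (actD g) (hcompat g), thetaIotaLim, thetaIotaLim,
      T.image_iotaInvariants_of_conj (actD g) (iota ι) (iota ι') hι' (hθ g)]
  · change (act g) '' T.envSet (T.thetaInftyIotaLim (iota ι)) = T.envSet (T.thetaInftyIotaLim (iota ι'))
    rw [T.image_envSet_of_compat (act g) (actD g) (hcompat g), thetaInftyIotaLim, thetaInftyIotaLim,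
      T.image_iotaInvariants_of_conj (actD g) (iota ι) (iota ι') hι' (hinf g)]

end Permuted

/-! ### Consistency with the decl of record `IotaInvariantTheta'` ([IUTchII] Prop. 2.2 (ii)′) -/

section OfRecord

variable {S' : BadPlaceSetting.{u}} {F' : ModelFamily S'.toThetaSetting} {Sys' : MonoThetaProjSystem F'}
  (T' : ThetaEnvData Sys') {Tc : TemperedCoverings S' Sys'.PiX} {Dec : SubgraphDecomposition S' Tc T'.D}

/-- The image in the limit of abc-iut-L6-t19's `θ^ι(Π_v)` (`IotaInvariantTheta'.thetaIota`, classes of `H¹(Π_Ÿ(Π_v), ·)`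
`ι`-invariant up to torsion for `iotaH1`) lies in the limit-level `ι`-invariants up to torsion for the companion action
`iotaLim` used by the bridge (`iota_compat`). [claim: Mochizuki2012, status: disputed] (IUTchII §2 Prop 2.2 (ii), kurims p.66) -/
theorem toLim_image_thetaIota_subset (Θ : IotaInvariantTheta' Dec) :
    T'.D.coh.toLim ⊤ '' Θ.thetaIota ⊆ T'.thetaIotaLim Θ.iotaLim := by
  rintro x ⟨t, ⟨ht, htor⟩, rfl⟩
  rw [mem_thetaIotaLim_iff]
  refine ⟨⟨t, ht, rfl⟩, ?_⟩
  rw [← Θ.iota_compat, ← map_sub]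
  exact (T'.D.coh.toLim ⊤).isOfFinAddOrder htor

/-- Conversely, when the kernel of `H¹(Π_Ÿ(Π_v), (l·Δ_Θ)) → lim_J` consists of torsion classes (true for inflation maps
along finite-index subgroups — restriction–corestriction — but not recorded by the abstract `CohomologySystem`; stated as
the hypothesis it is), the two notions agree: `θ^ι(Π_v)` read in the limit IS the bridge's `θ^ι`.
[claim: Mochizuki2012, status: disputed] (IUTchII §2 Prop 2.2 (ii), kurims p.66) -/
theorem toLim_image_thetaIota_eq (Θ : IotaInvariantTheta' Dec)
    (hker : ∀ y : T'.D.coh.H1 ⊤, T'.D.coh.toLim ⊤ y = 0 → IsOfFinAddOrder y) :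
    T'.D.coh.toLim ⊤ '' Θ.thetaIota = T'.thetaIotaLim Θ.iotaLim := by
  refine Set.Subset.antisymm (T'.toLim_image_thetaIota_subset Θ) ?_
  rintro x hx
  rw [mem_thetaIotaLim_iff] at hx
  obtain ⟨⟨t, ht, rfl⟩, htor⟩ := hx
  refine ⟨t, ⟨ht, ?_⟩, rfl⟩
  rw [← Θ.iota_compat, ← map_sub] at htor
  -- `n • toLim (ι t - t) = 0` for some `n > 0`, so `toLim (n • (ι t - t)) = 0`, so `n • (ι t - t)` is torsion
  obtain ⟨n, hn, hn0⟩ := htor.exists_nsmul_eq_zero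
  rw [← map_nsmul] at hn0
  obtain ⟨m, hm, hm0⟩ := (hker _ hn0).exists_nsmul_eq_zero
  rw [smul_smul] at hm0
  exact isOfFinAddOrder_iff_nsmul_eq_zero.2 ⟨m * n, Nat.mul_pos hm hn, hm0⟩

end OfRecord

end ThetaEnvData

end Literature.IUT.HodgeArakelov
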